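import Literature.Analysis.FluidPDE.IsometryInvariance
import HarnessLib

/-!
# Crux `SelfMixingDichotomy.CoherentScaleExclusion` (stmt-NavierStokesRegularity-1423), line
  `registered`: stub SW3 `stub_heatSolution_comp_linearIsometryEquiv` — admissible heat solutions
  are carried to admissible heat solutions by linear isometries

Support file (`--supports stmt-NavierStokesRegularity-1423`) of the line lead c3 for the
amplitude-free coherence package (sphere-tangential drifts never stir radial blobs). For `a < b`,
a linear isometry `R` of `ℝ³` and a scalar `θ` that is jointly `C^∞` on the closed slab
`[a, b] × ℝ³` (`IsSmoothSpaceTimeOn (Icc a b) θ`), has uniform rapid decay of all within-slab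
space–time derivatives (`HasUniformRapidDecayOn (Icc a b) θ`) and solves the heat equation
`∂ₜθ = Δθ` with the one-sided time derivative `timeDerivWithin (Icc a b)`, the function
`(t, x) ↦ θ t (R⁻¹ x)` has the same three properties.

Proof (everything is in `Literature/Analysis/FluidPDE/IsometryInvariance`).
1. Smoothness: `IsSmoothSpaceTimeOn.comp_linearIsometryEquiv_symm`.
2. Decay (`HeatIsometry.hasUniformRapidDecayOn_comp_linearIsometryEquiv_symm`, the scalar version
   of `HasUniformRapidDecayOn.conj_linearIsometryEquiv`): with the product isometry
   `Φ (t, x) = (t, R⁻¹ x)` of `ℝ × E` one has `uncurry (θ ∘ R⁻¹) = uncurry θ ∘ Φ`,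
   `Φ ⁻¹' (S × E) = S × E`, so `LinearIsometryEquiv.norm_iteratedFDerivWithin_comp_right` gives
   `‖Dⁿ(uncurry (θ ∘ R⁻¹))(t, x)‖ = ‖Dⁿ(uncurry θ)(t, R⁻¹ x)‖`, and `‖R⁻¹ x‖ = ‖x‖`; the slab
   `Icc a b` has unique differentiability (`uniqueDiffOn_Icc`).
3. Equation: `timeDerivWithin_comp_linearIsometryEquiv_symm` (definitional) and
   `laplacian_comp_linearIsometryEquiv_symm` (`Δ(g ∘ R⁻¹)(x) = Δ g (R⁻¹ x)`).
-/

noncomputable section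

open Set Function
open scoped ContDiff Laplacian

-- `Summit = Problem` for this summit; the tree lakefile sets `weak.linter.dupNamespace = false`.
set_option linter.dupNamespace false

namespace Summit.NavierStokesRegularity.NavierStokesRegularity.Theorems

open Literature.Analysis.FluidPDE

namespace HeatIsometry

/-- **Composition on the right with a linear isometry preserves uniform rapid decay** (scalar /
general-target version of `HasUniformRapidDecayOn.conj_linearIsometryEquiv`): on a time set `S` of
unique differentiability, the within-slab space–time derivatives of `(t, x) ↦ w t (R⁻¹ x)` at
`(t, x)` have the same norms as those of `w` at `(t, R⁻¹ x)`
(`LinearIsometryEquiv.norm_iteratedFDerivWithin_comp_right` for the product isometry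
`(t, x) ↦ (t, R⁻¹ x)`), and `‖R⁻¹ x‖ = ‖x‖`. -/
theorem hasUniformRapidDecayOn_comp_linearIsometryEquiv_symm
    {E : Type*} [NormedAddCommGroup E] [InnerProductSpace ℝ E]
    {F : Type*} [NormedAddCommGroup F] [NormedSpace ℝ F]
    (R : E ≃ₗᵢ[ℝ] E) {S : Set ℝ} {w : ℝ → E → F}
    (hd : HasUniformRapidDecayOn S w) (hS : UniqueDiffOn ℝ S) :
    HasUniformRapidDecayOn S (fun t x => w t (R.symm x)) := by
  intro n K
  obtain ⟨C, hC⟩ := hd n K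
  refine ⟨C, fun t ht x => ?_⟩
  let Φ : (ℝ × E) ≃ₗᵢ[ℝ] (ℝ × E) :=
    ⟨(LinearEquiv.refl ℝ ℝ).prodCongr R.symm.toLinearEquiv, fun z => by simp [Prod.norm_def]⟩
  have hΦ : ∀ z, Φ z = (z.1, R.symm z.2) := fun z => rfl
  have h1 : uncurry (fun t x => w t (R.symm x)) = uncurry w ∘ Φ := by
    funext z; rfl
  have hpre : Φ ⁻¹' (S ×ˢ (univ : Set E)) = S ×ˢ univ := by
    ext z; simp [hΦ]
  have hU : UniqueDiffOn ℝ (S ×ˢ (univ : Set E)) := hS.prod uniqueDiffOn_univ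
  have h2 := LinearIsometryEquiv.norm_iteratedFDerivWithin_comp_right Φ (uncurry w) hU
    (x := (t, x)) (by rw [hΦ]; exact ⟨ht, mem_univ _⟩) n
  rw [hpre] at h2
  rw [h1, h2, hΦ]
  simpa using hC t ht (R.symm x)

end HeatIsometry

/-- **SW3 — admissible heat solutions are carried to admissible heat solutions by linear
isometries** (registered sub-goal `stub_heatSolution_comp_linearIsometryEquiv` of the crux
`CoherentScaleExclusion`, line `registered`, lead c3). For `a < b`, a linear isometry `R` of `ℝ³`
and `θ` jointly smooth with uniform rapid decay on `[a, b] × ℝ³` solving the heat equation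
`∂ₜθ = Δθ` there (one-sided time derivative within `[a, b]`), the function `(t, x) ↦ θ t (R⁻¹ x)`
is again jointly smooth with uniform rapid decay and solves the heat equation
(`IsSmoothSpaceTimeOn.comp_linearIsometryEquiv_symm`, `timeDerivWithin_comp_linearIsometryEquiv_symm`,
`laplacian_comp_linearIsometryEquiv_symm` of `Literature/Analysis/FluidPDE/IsometryInvariance`; the
decay transfer is `HeatIsometry.hasUniformRapidDecayOn_comp_linearIsometryEquiv_symm`). -/
theorem stub_heatSolution_comp_linearIsometryEquiv :
    ∀ (a b : ℝ), a < b →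
      ∀ (R : EuclideanSpace ℝ (Fin 3) ≃ₗᵢ[ℝ] EuclideanSpace ℝ (Fin 3))
        (θ : ℝ → EuclideanSpace ℝ (Fin 3) → ℝ),
      IsSmoothSpaceTimeOn (Set.Icc a b) θ → HasUniformRapidDecayOn (Set.Icc a b) θ →
      (∀ t ∈ Set.Icc a b, ∀ x : EuclideanSpace ℝ (Fin 3),
        timeDerivWithin (Set.Icc a b) θ t x = Laplacian.laplacian (θ t) x) →
      IsSmoothSpaceTimeOn (Set.Icc a b) (fun t x => θ t (R.symm x)) ∧
      HasUniformRapidDecayOn (Set.Icc a b) (fun t x => θ t (R.symm x)) ∧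
      (∀ t ∈ Set.Icc a b, ∀ x : EuclideanSpace ℝ (Fin 3),
        timeDerivWithin (Set.Icc a b) (fun t x => θ t (R.symm x)) t x =
          Laplacian.laplacian (fun y => θ t (R.symm y)) x) := by
  intro a b hab R θ hs hd heq
  refine ⟨hs.comp_linearIsometryEquiv_symm R,
    HeatIsometry.hasUniformRapidDecayOn_comp_linearIsometryEquiv_symm R hd (uniqueDiffOn_Icc hab),
    fun t ht x => ?_⟩
  rw [timeDerivWithin_comp_linearIsometryEquiv_symm, heq t ht (R.symm x),
    laplacian_comp_linearIsometryEquiv_symm R (θ t) x]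

end Summit.NavierStokesRegularity.NavierStokesRegularity.Theorems
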